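import Summits.SmoothPoincare4.SmoothPoincare4.Theorems.InformationMetricHadamardHadamardConvexBoundarySphereConvex
import HarnessLib

/-!
# The radial projection of the smooth frontier of a convex body onto the unit sphere
(helper file for route InformationMetricHadamard, item `HadamardConvexBoundarySphere`,
stmt-SmoothPoincare4-6016)

Setting: a Cartan–Hadamard manifold `(M, g)` (simply connected, geodesically complete,
`Rm(X,Y,Y,X) ≤ 0`), a closed convex set `C` (betweenness form), an interior point `o`, the
diffeomorphism `Φ = exp_o : E ≅ M` (`HadamardConvex.exists_expDiffeomorph`), and a `C^∞` map
`j : N → M` from a manifold `N` into `frontier C`. The radial projection is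
`Λ(y) = Φ⁻¹(j y)/‖Φ⁻¹(j y)‖ ∈ E` (Euclidean normalisation; `E` an inner product space).

* `mfderiv_apply_ne_symm` — TRANSVERSALITY: the initial velocity `exp_{j x}⁻¹(o)` of the segment
  from a frontier point `j x` to the interior point `o` is not tangent to `j` at `x` (chart-line
  argument with the cone lemma `apply_smul_mem_interior`);
* `mfderiv_normalize_injective` — hence `dΛ_x` is injective when `d j_x` is (reversal of the
  segment, `expMap_neg_of_eq`, turns the velocity of the ray from `o` at `j x` into `−exp_{j x}⁻¹ o`);
* `normalize_injective`, `exists_normalize_eq` — `Λ` is injective for injective `j` (a ray meets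
  the frontier once, `expMap_smul_mem_interior_of_mem_frontier`) and attains every unit vector when
  `frontier C ⊆ j(N)` and `C` is compact (`exists_exit`).

This is the classical "radial projection from an interior point of a compact convex body with
smooth boundary is a diffeomorphism onto the sphere" in a Hadamard manifold (Eberlein–O'Neill
1973, §1; Lee 2018, Ch. 12), split into its set-theoretic and differential halves; the inverse
function theorem is applied in the item's main file. Everything is proved; no definitions, no
named facts.

## References

* P. Eberlein, B. O'Neill, *Visibility manifolds*, Pacific J. Math. 46 (1973), §1.
  [EberleinOneill1973]
* J. M. Lee, *Introduction to Riemannian Manifolds*, 2nd ed. (2018), Thm. 12.8, Prop. 5.19.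
  [LeeRiemannianManifolds2018]
-/

noncomputable section

-- the registered namespace `Summit.SmoothPoincare4.SmoothPoincare4.Theorems` repeats a component
set_option linter.dupNamespace false

open Bundle Set Filter Function
open scoped Manifold ContDiff Topology Pointwise

namespace Summit.SmoothPoincare4.SmoothPoincare4.Theorems

namespace HadamardConvexBoundary

open Literature.Geometry.Lorentzian Literature.Geometry.Riemannian
open Literature.Geometry.Lorentzian.PseudoRiemannianMetric
open HadamardConvex

/-! ## The radial projection of the frontier onto the unit sphere of `T_oM` -/

section Radial

variable {E : Type*} [NormedAddCommGroup E] [InnerProductSpace ℝ E] {H : Type*}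
  [TopologicalSpace H] {I : ModelWithCorners ℝ E H} {M : Type*} [TopologicalSpace M]
  [ChartedSpace H M] [IsManifold I ∞ M] [FiniteDimensional ℝ E] [CompleteSpace E] [T2Space M]
  [I.Boundaryless] [SimplyConnectedSpace M] [LocallyPathConnectedSpace M]
  {g : PseudoRiemannianMetric I ∞ E (TangentSpace I : M → Type _)} [g.HasLeviCivita]
  [CovariantDerivative.ContMDiffCovariantDerivative g.leviCivita 1]
  [CovariantDerivative.ContMDiffCovariantDerivative g.leviCivita ∞]
  {C : Set M}
  {E' : Type*} [NormedAddCommGroup E'] [NormedSpace ℝ E'] {H' : Type*} [TopologicalSpace H']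
  {I' : ModelWithCorners ℝ E' H'} [I'.Boundaryless] {N : Type*} [TopologicalSpace N]
  [ChartedSpace H' N]

omit [IsManifold I ∞ M] [FiniteDimensional ℝ E] [CompleteSpace E] [T2Space M] [I.Boundaryless]
  [SimplyConnectedSpace M] [LocallyPathConnectedSpace M] [g.HasLeviCivita]
  [CovariantDerivative.ContMDiffCovariantDerivative g.leviCivita 1]
  [CovariantDerivative.ContMDiffCovariantDerivative g.leviCivita ∞] [TopologicalSpace N] in
/-- **Frontier points are not the centre**: for `o ∈ interior C`, a map `j` into `frontier C`
and a bijection `Φ : T_oM ≅ M` with `Φ 0 = o`, the vectors `Φ⁻¹(j y)` are nonzero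
(`interior C ∩ frontier C = ∅`). [folklore] -/
theorem symm_ne_zero {o : M} (ho : o ∈ interior C) {j : N → M}
    (hrange : range j ⊆ frontier C) (Φ : E ≃ₘ^∞⟮𝓘(ℝ, E), I⟯ M) (hΦ0 : Φ 0 = o) (y : N) :
    Φ.symm (j y) ≠ 0 := by
  intro h0
  have h1 : j y = o := by
    have h := Φ.apply_symm_apply (j y)
    rw [h0, hΦ0] at h
    exact h.symm
  have hfr : j y ∈ frontier C := hrange (mem_range_self y)
  rw [h1] at hfr
  exact Set.disjoint_left.1 disjoint_interior_frontier ho hfr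

/-- **No ray from an interior point is tangent to the frontier (chart-level core).** Let `C` be a
closed convex set of the Cartan–Hadamard manifold `M`, `o ∈ interior C`, `j : N → M` a `C^∞` map
into `frontier C`, `x ∈ N`, and `Φ = exp_{j x} : E ≅ M`. Then the vector `a = Φ⁻¹ o` (the initial
velocity of the segment from `j x` to `o`) is NOT in the range of `d j_x`. For if `d j_x(ζ) = a`,
the pulled-back map `P = Φ⁻¹ ∘ j` has `P x = 0` and `dP_x(ζ) = a` (`d(exp)_0 = id`), so along the
chart line through `x` in direction `ζ` the slopes `t⁻¹ P(x_t)` tend to `a`; for small `t > 0` the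
point `P(x_t) = t · (t⁻¹ P(x_t))` lies in the cone over the open set `Φ⁻¹(interior C) ∋ a`, which
`Φ` maps into `interior C` (`apply_smul_mem_interior`) — but `Φ(P(x_t)) = j(x_t) ∈ frontier C`.
This is the transversality half of "radial projection of a smooth convex hypersurface is a local
diffeomorphism" (Eberlein–O'Neill 1973, §1; Lee 2018, Ch. 12). [cite: EberleinOneill1973, §1] -/
theorem mfderiv_apply_ne_symm (hg : g.IsRiemannian) (hc : IsGeodesicallyComplete g.leviCivita)
    (hsec : ∀ (x : M) (X Y : TangentSpace I x), g.curvatureForm g.leviCivita x X Y Y X ≤ 0)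
    (hconv : ∀ p ∈ C, ∀ q ∈ C, ∀ m : M,
      g.edist hg p m + g.edist hg m q = g.edist hg p q → m ∈ C)
    (hCcl : IsClosed C) {o : M} (ho : o ∈ interior C) {j : N → M} (hj : ContMDiff I' I ∞ j)
    (hrange : range j ⊆ frontier C) (x : N) (Φ : E ≃ₘ^∞⟮𝓘(ℝ, E), I⟯ M)
    (hΦ : ∀ v : E, Φ v = expMap g.leviCivita (j x) v) (ζ : TangentSpace I' x) :
    mfderiv I' I j x ζ ≠ Φ.symm o := by
  intro hζ
  have hp : j x ∈ C := hCcl.frontier_subset (hrange (mem_range_self x))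
  have hΦ0 : Φ 0 = j x := by rw [hΦ]; exact expMap_zero (cov := g.leviCivita) (j x)
  have hΦsymm : Φ.symm (j x) = 0 := by rw [← hΦ0]; exact Φ.symm_apply_apply 0
  have hinf : (∞ : ℕ∞ω) ≠ 0 := by simp
  -- the pulled-back map `P = Φ⁻¹ ∘ j : N → E`
  set P : N → E := fun y ↦ Φ.symm (j y) with hP
  have hPs : ContMDiff I' 𝓘(ℝ, E) ∞ P := Φ.symm.contMDiff.comp hj
  have hPx : P x = 0 := hΦsymm
  have hPd : MDifferentiableAt I' 𝓘(ℝ, E) P x := (hPs x).mdifferentiableAt hinf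
  have hjd : MDifferentiableAt I' I j x := (hj x).mdifferentiableAt hinf
  have hΦd : ∀ v : E, MDifferentiableAt 𝓘(ℝ, E) I Φ v := fun v ↦
    (Φ.contMDiff v).mdifferentiableAt hinf
  have hΦsd : ∀ y : M, MDifferentiableAt I 𝓘(ℝ, E) Φ.symm y := fun y ↦
    (Φ.symm.contMDiff y).mdifferentiableAt hinf
  -- `dΦ_0 = id`, hence `d(Φ⁻¹)_{j x} = id`
  have hdΦ0 : mfderiv 𝓘(ℝ, E) I Φ 0 = ContinuousLinearMap.id ℝ E := by
    have hfun : (Φ : E → M) = fun v : E ↦ expMap g.leviCivita (j x) v := funext hΦ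
    rw [hfun]
    exact mfderiv_expMap_zero (cov := g.leviCivita) (j x)
  have hdΦsymm : ∀ w : E, mfderiv I 𝓘(ℝ, E) Φ.symm (j x) w = w := by
    intro w
    have h1 : mfderiv I I ((Φ : E → M) ∘ Φ.symm) (j x) =
        (mfderiv 𝓘(ℝ, E) I Φ (Φ.symm (j x))).comp (mfderiv I 𝓘(ℝ, E) Φ.symm (j x)) :=
      mfderiv_comp (j x) (hΦd _) (hΦsd _)
    have h2 : ((Φ : E → M) ∘ Φ.symm) = id := funext fun y ↦ Φ.apply_symm_apply y
    rw [h2, mfderiv_id, hΦsymm, hdΦ0] at h1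
    have h3 := congrArg (fun L : TangentSpace I (j x) →L[ℝ] TangentSpace I (j x) ↦ L w) h1
    change w = mfderiv I 𝓘(ℝ, E) Φ.symm (j x) w at h3
    exact h3.symm
  -- `dP_x ζ = a := Φ⁻¹ o`
  set a : E := Φ.symm o with ha
  set L := mfderiv I' 𝓘(ℝ, E) P x with hL
  have hLζ : L ζ = a := by
    have h1 : mfderiv I' 𝓘(ℝ, E) P x =
        (mfderiv I 𝓘(ℝ, E) Φ.symm (j x)).comp (mfderiv I' I j x) :=
      mfderiv_comp x (hΦsd _) hjd
    rw [hL, h1]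
    change mfderiv I 𝓘(ℝ, E) Φ.symm (j x) (mfderiv I' I j x ζ) = a
    rw [hζ, hdΦsymm]
  -- the derivative of `P` along the chart line through `x` in direction `ζ`
  set ζ' : E' := ζ with hζ'
  have hQ : HasFDerivAt (writtenInExtChartAt I' 𝓘(ℝ, E) x P) L (extChartAt I' x x) := by
    have h := hPd.hasMFDerivAt.2
    rw [ModelWithCorners.range_eq_univ, hasFDerivWithinAt_univ] at h
    exact h
  set f : ℝ → E := fun t ↦
    writtenInExtChartAt I' 𝓘(ℝ, E) x P (extChartAt I' x x + t • ζ') with hf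
  have hfd : HasDerivAt f a 0 := by
    have hl : HasDerivAt (fun t : ℝ ↦ extChartAt I' x x + t • ζ') ((1 : ℝ) • ζ') 0 :=
      ((hasDerivAt_id (0 : ℝ)).smul_const ζ').const_add (extChartAt I' x x)
    rw [one_smul] at hl
    have h0 : extChartAt I' x x + (0 : ℝ) • ζ' = extChartAt I' x x := by
      rw [zero_smul, add_zero]
    have hQ' : HasFDerivAt (writtenInExtChartAt I' 𝓘(ℝ, E) x P) L
        (extChartAt I' x x + (0 : ℝ) • ζ') := by
      rw [h0]; exact hQ
    have h := hQ'.comp_hasDerivAt (0 : ℝ) hl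
    have h' : HasDerivAt f (L ζ) 0 := h
    rw [hLζ] at h'
    exact h'
  have hfval : ∀ t : ℝ,
      f t = P ((extChartAt I' x).symm (extChartAt I' x x + t • ζ')) := by
    intro t
    simp only [hf, writtenInExtChartAt, Function.comp_apply, extChartAt_model_space_eq_id,
      PartialEquiv.refl_coe, id_eq]
  have hf0 : f 0 = 0 := by
    rw [hfval, zero_smul, add_zero, extChartAt_to_inv]
    exact hPx
  -- slopes converge to `a`; pick a small `t > 0` with `t⁻¹ • f t ∈ Φ⁻¹(interior C)`
  have hU : (Φ : E → M) ⁻¹' interior C ∈ 𝓝 a :=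
    (isOpen_interior.preimage Φ.continuous).mem_nhds (by
      show Φ (Φ.symm o) ∈ interior C
      rw [Φ.apply_symm_apply]; exact ho)
  have hslope : Tendsto (fun t : ℝ ↦ t⁻¹ • f t) (𝓝[≠] 0) (𝓝 a) := by
    have h := hfd.tendsto_slope_zero
    simp only [zero_add, hf0, sub_zero] at h
    exact h
  have hev1 : ∀ᶠ t in 𝓝[>] (0 : ℝ), t⁻¹ • f t ∈ (Φ : E → M) ⁻¹' interior C :=
    (hslope.mono_left (nhdsGT_le_nhdsNE 0)).eventually_mem hU
  have hev2 : ∀ᶠ t in 𝓝[>] (0 : ℝ), t ∈ Ioo (0 : ℝ) 1 := Ioo_mem_nhdsGT zero_lt_one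
  obtain ⟨t, ht1, ht2⟩ := (hev1.and hev2).exists
  -- `Φ (f t)` is an interior point ...
  have hint : Φ (f t) ∈ interior C := by
    have h := apply_smul_mem_interior hg hc hsec hconv hp Φ hΦ ht1 ⟨ht2.1, ht2.2.le⟩
    rwa [smul_inv_smul₀ ht2.1.ne'] at h
  -- ... and a frontier point
  have hfr : Φ (f t) ∈ frontier C := by
    rw [hfval, hP]
    beta_reduce
    rw [Φ.apply_symm_apply]
    exact hrange (mem_range_self _)
  exact Set.disjoint_left.1 disjoint_interior_frontier hint hfr

/-- **The differential of the radial projection is injective.** Setting: `C` closed convex in the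
Cartan–Hadamard manifold `M`, `o ∈ interior C`, `Φ = exp_o : E ≅ M`, and `j : N → M` a `C^∞` map
into `frontier C` with injective differentials. Then the map
`Λ(y) = Φ⁻¹(j y)/‖Φ⁻¹(j y)‖ : N → E` has injective differential at every `x`: a vector `ξ` in its
kernel has `d(Φ⁻¹ ∘ j)_x ξ` proportional to `w = Φ⁻¹(j x)` (`exists_eq_smul_of_fderiv_normalize_eq_zero`),
so for `ξ ≠ 0` the radial direction `w` is tangent to `Φ⁻¹(j N)` at `w`, i.e. the velocity
`d(exp_o)_w w = γ_w'(1)` of the ray is `d j_x(ξ')`; reversing the segment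
(`expMap_neg_of_eq`: `γ_w'(1) = −exp_{j x}⁻¹(o)`) this contradicts `mfderiv_apply_ne_symm`.
[cite: EberleinOneill1973, §1] -/
theorem mfderiv_normalize_injective (hg : g.IsRiemannian)
    (hc : IsGeodesicallyComplete g.leviCivita)
    (hsec : ∀ (x : M) (X Y : TangentSpace I x), g.curvatureForm g.leviCivita x X Y Y X ≤ 0)
    (hconv : ∀ p ∈ C, ∀ q ∈ C, ∀ m : M,
      g.edist hg p m + g.edist hg m q = g.edist hg p q → m ∈ C)
    (hCcl : IsClosed C) {o : M} (ho : o ∈ interior C) {j : N → M} (hj : ContMDiff I' I ∞ j)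
    (hjimm : ∀ x : N, Injective (mfderiv I' I j x)) (hrange : range j ⊆ frontier C)
    (Φ : E ≃ₘ^∞⟮𝓘(ℝ, E), I⟯ M) (hΦ : ∀ v : E, Φ v = expMap g.leviCivita o v) (x : N) :
    Injective (mfderiv I' 𝓘(ℝ, E) (fun y : N ↦ ‖Φ.symm (j y)‖⁻¹ • Φ.symm (j y)) x) := by
  have hinf : (∞ : ℕ∞ω) ≠ 0 := by simp
  have hΦ0 : Φ 0 = o := by rw [hΦ]; exact expMap_zero (cov := g.leviCivita) o
  set P : N → E := fun y ↦ Φ.symm (j y) with hP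
  set nrm : E → E := fun v ↦ ‖v‖⁻¹ • v with hnrm
  have hw : P x ≠ 0 := symm_ne_zero ho hrange Φ hΦ0 x
  -- differentials
  have hPs : ContMDiff I' 𝓘(ℝ, E) ∞ P := Φ.symm.contMDiff.comp hj
  have hPd : MDifferentiableAt I' 𝓘(ℝ, E) P x := (hPs x).mdifferentiableAt hinf
  have hnd : DifferentiableAt ℝ nrm (P x) := differentiableAt_normalize hw
  have hcomp : HasMFDerivAt I' 𝓘(ℝ, E) (nrm ∘ P) x
      ((fderiv ℝ nrm (P x)).comp (mfderiv I' 𝓘(ℝ, E) P x)) :=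
    (hasMFDerivAt_iff_hasFDerivAt.2 hnd.hasFDerivAt).comp x hPd.hasMFDerivAt
  have hmf : mfderiv I' 𝓘(ℝ, E) (fun y : N ↦ ‖Φ.symm (j y)‖⁻¹ • Φ.symm (j y)) x =
      (fderiv ℝ nrm (P x)).comp (mfderiv I' 𝓘(ℝ, E) P x) := hcomp.mfderiv
  rw [hmf]
  -- `dP_x` is injective
  have hPinj : Injective (mfderiv I' 𝓘(ℝ, E) P x) := by
    have h1 : mfderiv I' 𝓘(ℝ, E) P x =
        (mfderiv I 𝓘(ℝ, E) Φ.symm (j x)).comp (mfderiv I' I j x) :=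
      mfderiv_comp x ((Φ.symm.contMDiff _).mdifferentiableAt hinf)
        ((hj x).mdifferentiableAt hinf)
    have h2 : Injective (mfderiv I 𝓘(ℝ, E) Φ.symm (j x)) := by
      have h3 := (Φ.symm.mfderivToContinuousLinearEquiv hinf (j x)).injective
      rw [← ContinuousLinearEquiv.coe_coe, Diffeomorph.mfderivToContinuousLinearEquiv_coe] at h3
      exact h3
    rw [h1, ContinuousLinearMap.coe_comp]
    exact h2.comp (hjimm x)
  -- a kernel vector `ξ` of `d(nrm ∘ P)_x`
  refine (injective_iff_map_eq_zero _).2 fun ξ hξ ↦ ?_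
  by_contra hne
  change fderiv ℝ nrm (P x) (mfderiv I' 𝓘(ℝ, E) P x ξ) = 0 at hξ
  obtain ⟨μ, hμ⟩ := exists_eq_smul_of_fderiv_normalize_eq_zero hw hξ
  have hη : mfderiv I' 𝓘(ℝ, E) P x ξ ≠ 0 := fun h0 ↦ hne (hPinj (by rw [h0, map_zero]))
  have hμ0 : μ ≠ 0 := by
    rintro rfl
    rw [zero_smul] at hμ
    exact hη hμ
  have hw' : mfderiv I' 𝓘(ℝ, E) P x (μ⁻¹ • ξ) = P x := by
    rw [map_smul, hμ]
    change μ⁻¹ • μ • P x = P x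
    rw [smul_smul, inv_mul_cancel₀ hμ0, one_smul]
  -- the velocity `V = dΦ_w(w)` of the ray from `o` through `j x` is tangent to `j` at `x`
  obtain ⟨V, hV⟩ : ∃ V : E, mfderiv 𝓘(ℝ, E) I Φ (P x) (P x) = V := ⟨_, rfl⟩
  have hjξ : mfderiv I' I j x (μ⁻¹ • ξ) = V := by
    have hjfun : j = (Φ : E → M) ∘ P := funext fun y ↦ (Φ.apply_symm_apply (j y)).symm
    have h1 : mfderiv I' I ((Φ : E → M) ∘ P) x =
        (mfderiv 𝓘(ℝ, E) I Φ (P x)).comp (mfderiv I' 𝓘(ℝ, E) P x) :=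
      mfderiv_comp x ((Φ.contMDiff _).mdifferentiableAt hinf) hPd
    rw [hjfun, h1]
    change mfderiv 𝓘(ℝ, E) I Φ (P x) (mfderiv I' 𝓘(ℝ, E) P x (μ⁻¹ • ξ)) = V
    rw [hw']
    exact hV
  -- reversal: `exp_{j x}(−V) = o`
  have hjx : expMap g.leviCivita o (P x) = j x := by
    rw [← hΦ]; exact Φ.apply_symm_apply (j x)
  have hVeq : mfderiv 𝓘(ℝ, E) I (fun w : E ↦ expMap g.leviCivita o w) (P x) (P x) = V := by
    have hfun : (fun w : E ↦ expMap g.leviCivita o w) = (Φ : E → M) := (funext hΦ).symm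
    rw [hfun]
    exact hV
  have hrev : expMap g.leviCivita (j x) (-(V : TangentSpace I (j x))) = o :=
    expMap_neg_of_eq hc o (P x) hjx hVeq
  -- in terms of `Φp = exp_{j x}`: `Φp⁻¹ o = −V = d j_x (−μ⁻¹ ξ)`, contradicting transversality
  obtain ⟨Φp, hΦp'⟩ := exists_expDiffeomorph hg hc hsec (j x)
  have hΦp : ∀ v : E, Φp v = expMap g.leviCivita (j x) v := fun v ↦ congrFun hΦp' v
  have ha : Φp.symm o = -V := by
    rw [← hrev, ← hΦp]
    exact Φp.symm_apply_apply _
  refine mfderiv_apply_ne_symm hg hc hsec hconv hCcl ho hj hrange x Φp hΦp (-(μ⁻¹ • ξ)) ?_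
  rw [map_neg, hjξ, ha]
  rfl

omit [TopologicalSpace N] in
/-- **The radial projection is injective**: with `C` closed convex, `o ∈ interior C`,
`Φ = exp_o` and `j : N → frontier C` injective, `Λ(y) = Φ⁻¹(j y)/‖Φ⁻¹(j y)‖` is injective on `N` —
two frontier points on one ray from `o` coincide, since strictly between `o` and a frontier point
of a ray there are only interior points (`expMap_smul_mem_interior_of_mem_frontier`).
[cite: EberleinOneill1973, §1] -/
theorem normalize_injective (hg : g.IsRiemannian) (hc : IsGeodesicallyComplete g.leviCivita)
    (hsec : ∀ (x : M) (X Y : TangentSpace I x), g.curvatureForm g.leviCivita x X Y Y X ≤ 0)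
    (hconv : ∀ p ∈ C, ∀ q ∈ C, ∀ m : M,
      g.edist hg p m + g.edist hg m q = g.edist hg p q → m ∈ C)
    (hCcl : IsClosed C) {o : M} (ho : o ∈ interior C) {j : N → M} (hjinj : Injective j)
    (hrange : range j ⊆ frontier C) (Φ : E ≃ₘ^∞⟮𝓘(ℝ, E), I⟯ M)
    (hΦ : ∀ v : E, Φ v = expMap g.leviCivita o v) :
    Injective (fun y : N ↦ ‖Φ.symm (j y)‖⁻¹ • Φ.symm (j y)) := by
  have hΦ0 : Φ 0 = o := by rw [hΦ]; exact expMap_zero (cov := g.leviCivita) o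
  -- two frontier vectors on one ray are equal
  have key : ∀ {w w' : E}, Φ w ∈ frontier C → Φ w' ∈ frontier C → ∀ {c : ℝ}, 0 < c →
      w' = c • w → ¬ c < 1 := by
    intro w w' hw hw' c hc0 hcw hc1
    have h := expMap_smul_mem_interior_of_mem_frontier hg hc hsec hconv hCcl ho
      (w := (w : TangentSpace I o)) (by rw [← hΦ]; exact hw) hc0 hc1
    rw [← hΦ] at h
    have h' : Φ w' ∈ interior C := by rw [hcw]; exact h
    exact Set.disjoint_left.1 disjoint_interior_frontier h' hw'
  intro x x' hxx'
  set w : E := Φ.symm (j x) with hw_def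
  set w' : E := Φ.symm (j x') with hw'_def
  have hw0 : w ≠ 0 := symm_ne_zero ho hrange Φ hΦ0 x
  have hw0' : w' ≠ 0 := symm_ne_zero ho hrange Φ hΦ0 x'
  have hfw : Φ w ∈ frontier C := by
    rw [hw_def, Φ.apply_symm_apply]; exact hrange (mem_range_self x)
  have hfw' : Φ w' ∈ frontier C := by
    rw [hw'_def, Φ.apply_symm_apply]; exact hrange (mem_range_self x')
  have hn : ‖w‖ ≠ 0 := norm_ne_zero_iff.2 hw0
  have hn' : ‖w'‖ ≠ 0 := norm_ne_zero_iff.2 hw0'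
  -- `w' = c • w` with `c = ‖w'‖/‖w‖ > 0`
  have hxx : ‖w‖⁻¹ • w = ‖w'‖⁻¹ • w' := hxx'
  set c : ℝ := ‖w'‖ * ‖w‖⁻¹ with hc_def
  have hcpos : 0 < c := mul_pos (norm_pos_iff.2 hw0') (inv_pos.2 (norm_pos_iff.2 hw0))
  have hcw : w' = c • w := by
    calc w' = ‖w'‖ • (‖w'‖⁻¹ • w') := by rw [smul_smul, mul_inv_cancel₀ hn', one_smul]
      _ = ‖w'‖ • (‖w‖⁻¹ • w) := by rw [hxx]
      _ = c • w := by rw [smul_smul]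
  have hcw' : w = c⁻¹ • w' := by
    rw [hcw, smul_smul, inv_mul_cancel₀ hcpos.ne', one_smul]
  -- `c = 1`
  have hc1 : c = 1 := by
    rcases lt_trichotomy c 1 with h | h | h
    · exact absurd h (key hfw hfw' hcpos hcw)
    · exact h
    · exact absurd (inv_lt_one_of_one_lt₀ h) (key hfw' hfw (inv_pos.2 hcpos) hcw')
  rw [hc1, one_smul] at hcw
  apply hjinj
  have h := congrArg Φ hcw
  rw [hw'_def, hw_def, Φ.apply_symm_apply, Φ.apply_symm_apply] at h
  exact h.symm

omit [TopologicalSpace N] in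
/-- **The radial projection is onto the unit sphere**: with `C` compact convex, `o ∈ interior C`,
`Φ = exp_o` and `frontier C ⊆ j(N)`, every unit vector `u` of `E = T_oM` is `Φ⁻¹(j y)/‖Φ⁻¹(j y)‖`
for some `y` — the ray `exp_o(t u)` exits `C` through a frontier point `exp_o(T u)`, `T > 0`
(`exists_exit`). [cite: EberleinOneill1973, §1] -/
theorem exists_normalize_eq (hg : g.IsRiemannian) (hc : IsGeodesicallyComplete g.leviCivita)
    (hsec : ∀ (x : M) (X Y : TangentSpace I x), g.curvatureForm g.leviCivita x X Y Y X ≤ 0)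
    (hC : IsCompact C) {o : M} (ho : o ∈ interior C) {j : N → M}
    (hrange : frontier C ⊆ range j) (Φ : E ≃ₘ^∞⟮𝓘(ℝ, E), I⟯ M)
    (hΦ : ∀ v : E, Φ v = expMap g.leviCivita o v) {u : E} (hu : ‖u‖ = 1) :
    ∃ y : N, ‖Φ.symm (j y)‖⁻¹ • Φ.symm (j y) = u := by
  have hu0 : u ≠ 0 := by
    rintro rfl
    rw [norm_zero] at hu
    exact zero_ne_one hu
  obtain ⟨T, hT, hfr, -⟩ := exists_exit hg hc hsec hC ho (u := (u : TangentSpace I o)) hu0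
  obtain ⟨y, hy⟩ := hrange hfr
  refine ⟨y, ?_⟩
  have h1 : Φ.symm (j y) = T • u := by
    rw [hy, ← hΦ]; exact Φ.symm_apply_apply _
  rw [h1, norm_smul, Real.norm_eq_abs, abs_of_pos hT, hu, mul_one, smul_smul,
    inv_mul_cancel₀ hT.ne', one_smul]

end Radial

end HadamardConvexBoundary

end Summit.SmoothPoincare4.SmoothPoincare4.Theorems

end
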